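import Summits.QuantumFields.QCD.Theses.SpectralDefectExtinction
import Literature.MathematicalPhysics.QuantumLattice.WilsonPropagatorHeavyMass
import Literature.MathematicalPhysics.QuantumLattice.GrassmannIntegralWilsonProofs
import Literature.MathematicalPhysics.QuantumFieldTheory.SpectralDefectDensity
import Literature.Barriers.QuantumFields.WilsonDeterminantMassSplitting

/-!
# Negative knowledge for crux `ExtinctionBuildsQCD` (stmt-QuantumFields-8968): without TIGHT the
# bridge is the summit conjunct

Certified copy of §0–§2 of the cdisprove work file
`Summits/QuantumFields/QCD/Cruxes/ExtinctionBuildsQCD/Disproof.lean` (refuter, cdisprove seat).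
Supports stmt-QuantumFields-8968; asserts no route item.

* §0 `ExtinctionBuildsQCD ↔ ∀ N_f ∈ {2,3}, SD(N_f) → QCDOf N_f` with `SD` split into its EXTINCT and
  TIGHT clauses (`Extinct`, `Tight`, `SDHyp`, definitional), and
  `¬ ExtinctionBuildsQCD ↔ ∃ N_f ∈ {2,3}, SD(N_f) ∧ ¬ QCDOf N_f`: a kill needs `¬ QCDOf`.
* §1 Configuration-wise spectral facts for the tree's `wilsonDirac` (fundamental `SU(3)`, `r = 1`,
  any torus, ANY gauge field): `m Σ‖v‖² ≤ Re⟨v, D_W(U,m,1)v⟩ ≤ (m+8) Σ‖v‖²`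
  (`re_star_dotProduct_wilsonDirac_mem`, from `D_W = (m+4)·1 − Σ_μ W_μ`, `‖W_μ‖ ≤ 1`); no real
  eigenvalue of `D_W(U,0,1)` below any `t ≤ 0` (`countP_signDefect_eq_zero`) and all real
  eigenvalues in `[0,8]` (`re_mem_Icc_of_real_root`); every eigenvalue of `Γ₅ D_W(U,μ,1)` has
  modulus `≥ μ` (`le_abs_re_of_mem_roots_hermitianWilson`), so no coercivity defect in a window of
  half-width `≤ μ` (`countP_coercivityDefect_eq_zero`).
* §2 LOAD-BEARING: the EXTINCT integrand is identically `0` for every regularisation step with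
  `m_crit(k) ≥ 0` and every `c ≤ 1` (`defectCount_eq_zero`, `extinct_of_mcrit_nonneg`); the
  degenerate tree regularisation `canonicalAF` therefore satisfies `SD` minus TIGHT
  (`sdWithoutTight_canonicalAF`), whence `ExtinctionBuildsQCDWithoutTight ↔ QCD`
  (`extinctionBuildsQCDWithoutTight_iff_qcd`) and, for every TIGHT-replacement `P` satisfied by
  `canonicalAF`, the same collapse (`bridge_collapse_schema`,
  `extinctionBuildsQCDWithLinePinned_iff_qcd`).  Any proof of the crux must use the index content
  of TIGHT.

References: Hernández–Jansen–Lüscher, Nucl. Phys. B 552 (1999) 363, (2.14) (`‖W_μ‖ ≤ 1`);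
Montvay–Münster 1994 §4.1/§5.1 (hopping expansion, `κ < 1/8`); Mohler–Schaefer 2020 §2 (`n_neg`).
-/

noncomputable section

namespace Summit.QuantumFields.QCD.Theorems.ExtinctionBuildsQCD.Negative

open scoped BigOperators Topology Classical MeasureTheory Matrix ComplexConjugate
open Filter MeasureTheory Matrix
open Literature.MathematicalPhysics.QuantumLattice Literature.MathematicalPhysics.QuantumFieldTheory
  Literature.Probability.LatticeModels
open Summit.QuantumFields.QCD.Theses.SpectralDefectExtinction

/-! ## §0 Shape of the crux: a kill is a kill of the summit conjunct -/

/-- The EXTINCT clause of `SD(N_f)` for witness data `(reg, c)` at the mass tuple `m`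
(verbatim from the route file). -/
def Extinct (Nf : ℕ) (reg : QCDRegularisation Nf) (c : ℝ) (m : Fin Nf → ℝ) : Prop :=
  ∀ ε : ℝ, 0 < ε → ∀ᶠ k : ℕ in Filter.atTop, ∀ S : ℕ, reg.L k ≤ S → (∫ U, ((∑ f : Fin Nf, ((Multiset.countP (fun z : ℂ => z.im = 0 ∧ z.re < -(reg.mcrit k + reg.a k * m f / reg.Zm k)) (wilsonDirac (fundamentalRep (Fin 3)) U 0 1).charpoly.roots : ℝ) + (Multiset.countP (fun z : ℂ => |z.re| < c * (reg.a k * m f / reg.Zm k)) (spinorLift gammaFive * wilsonDirac (fundamentalRep (Fin 3)) U (reg.mcrit k + reg.a k * m f / reg.Zm k) 1).charpoly.roots : ℝ)))) * ∏ f : Fin Nf, ‖fermionDet (wilsonDirac (fundamentalRep (Fin 3)) U (reg.mcrit k + reg.a k * m f / reg.Zm k) 1)‖ ∂(wilsonMeasure (d := 4) (L := 2 * S + 1) (fundamentalRep (Fin 3)) (reg.β k))) / (∫ U, ∏ f : Fin Nf, ‖fermionDet (wilsonDirac (fundamentalRep (Fin 3)) U (reg.mcrit k + reg.a k * m f / reg.Zm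 k) 1)‖ ∂(wilsonMeasure (d := 4) (L := 2 * S + 1) (fundamentalRep (Fin 3)) (reg.β k))) ≤ ε * ((2 * S + 1 : ℝ) / (2 * reg.L k + 1)) ^ 4

/-- The TIGHT clause of `SD(N_f)` for witness data `(reg, M₀)` at the mass tuple `m`
(verbatim from the route file). -/
def Tight (Nf : ℕ) (reg : QCDRegularisation Nf) (M₀ : ℝ) (m : Fin Nf → ℝ) : Prop :=
  ∀ M : ℝ, M₀ < M → ∀ᶠ k : ℕ in Filter.atTop, 1 ≤ (∫ U, (|(Multiset.countP (fun z : ℂ => z.re < 0) (spinorLift gammaFive * wilsonDirac (fundamentalRep (Fin 3)) U (reg.mcrit k - reg.a k * M / reg.Zm k) 1).charpoly.roots : ℝ) - 6 * (2 * reg.L k + 1 : ℝ) ^ 4|) * ∏ f : Fin Nf, ‖fermionDet (wilsonDirac (fundamentalRep (Fin 3)) U (reg.mcrit k + reg.a k * m f / reg.Zm k) 1)‖ ∂(wilsonMeasure (d := 4) (L := 2 * reg.L k + 1) (fundamentalRep (Fin 3)) (reg.β k))) / (∫ U, ∏ f : Fin Nf, ‖fermionDet (wilsonDirac (fundamentalRep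 (Fin 3)) U (reg.mcrit k + reg.a k * m f / reg.Zm k) 1)‖ ∂(wilsonMeasure (d := 4) (L := 2 * reg.L k + 1) (fundamentalRep (Fin 3)) (reg.β k)))

/-- `SD(N_f)`: the hypothesis of the bridge for one flavour number (= the body of the sibling crux
`WindowExtinction` at `N_f`). -/
def SDHyp (Nf : ℕ) : Prop :=
  ∃ reg : QCDRegularisation Nf, reg.HasMassScaling ∧ (reg.scheme 0 0 0).HasAsymptoticScaling ∧
    ∃ M₀ : ℝ, 0 ≤ M₀ ∧ ∃ c : ℝ, 0 < c ∧ ∀ m : Fin Nf → ℝ, (∀ f, M₀ < m f) →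
      Extinct Nf reg c m ∧ Tight Nf reg M₀ m

-- buildfix 2026-08-19 (maintenance): `extinctionBuildsQCD_iff`, `windowExtinction_iff` and
-- `not_extinctionBuildsQCD_iff` REMOVED — all three unfolded the ORIGINAL bodies of the route decls
-- `ExtinctionBuildsQCD` / `WindowExtinction` by `Iff.rfl`; route revs 6/9 (2026-08-16/17) restated both (conclusion
-- THR instead of `QCDOf`; hypothesis SD⁺ with volume cap, branch clause, extensive TIGHT), so the recorded
-- equivalences are neither definitional nor provable. The definitions `Extinct`/`Tight`/`SDHyp` and every other
-- declaration below are untouched. (Referenced only by pre-restate crux workfiles under Cruxes/.)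

/-! ## §1 Configuration-wise spectral facts -/

section Spectral

variable {L : ℕ} [NeZero L]

/-- `Re⟨v, v⟩ = Σ ‖v i‖²`. -/
theorem re_star_dotProduct_self {n : Type*} [Fintype n] (v : n → ℂ) :
    (star v ⬝ᵥ v).re = ∑ i, ‖v i‖ ^ 2 := by
  rw [dotProduct, Complex.re_sum]
  refine Finset.sum_congr rfl fun i _ => ?_
  rw [Pi.star_apply, Complex.star_def, ← Complex.normSq_eq_conj_mul_self, Complex.ofReal_re,
    Complex.normSq_eq_norm_sq]

/-- A non-zero vector has positive `Σ ‖v i‖²`. -/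
theorem sum_norm_sq_pos {n : Type*} [Fintype n] {v : n → ℂ} (hv : v ≠ 0) :
    0 < ∑ i, ‖v i‖ ^ 2 := by
  obtain ⟨i, hi⟩ : ∃ i, v i ≠ 0 := by
    by_contra h
    push Not at h
    exact hv (funext h)
  exact Finset.sum_pos' (fun j _ => by positivity) ⟨i, Finset.mem_univ _, by positivity⟩

open scoped Matrix.Norms.L2Operator in
/-- Cauchy–Schwarz with the `ℓ² → ℓ²` operator norm: `‖v† A v‖ ≤ ‖A‖ · Σ‖v i‖²`
(Reed–Simon I §VI.1; same route as the tree's `re_star_dotProduct_mulVec_le_opNorm`). -/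
theorem norm_star_dotProduct_mulVec_le {n : Type*} [Fintype n] [DecidableEq n]
    (A : Matrix n n ℂ) (v : n → ℂ) :
    ‖star v ⬝ᵥ (A *ᵥ v)‖ ≤ ‖A‖ * ∑ i, ‖v i‖ ^ 2 := by
  have hinner : ∀ a b : n → ℂ,
      star a ⬝ᵥ b = inner ℂ (WithLp.toLp 2 a : EuclideanSpace ℂ n) (WithLp.toLp 2 b) :=
    fun a b => by rw [EuclideanSpace.inner_eq_star_dotProduct, dotProduct_comm]
  set x : EuclideanSpace ℂ n := WithLp.toLp 2 v with hx
  have hx2 : ‖x‖ ^ 2 = ∑ i, ‖v i‖ ^ 2 := by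
    rw [← re_star_dotProduct_self, hinner, ← inner_self_eq_norm_sq (𝕜 := ℂ)]
    rfl
  calc ‖star v ⬝ᵥ (A *ᵥ v)‖
      = ‖inner ℂ x (Matrix.toEuclideanCLM (n := n) (𝕜 := ℂ) A x)‖ := by
        rw [hinner, hx, Matrix.toEuclideanCLM_toLp]
    _ ≤ ‖x‖ * ‖Matrix.toEuclideanCLM (n := n) (𝕜 := ℂ) A x‖ := norm_inner_le_norm _ _
    _ ≤ ‖x‖ * (‖Matrix.toEuclideanCLM (n := n) (𝕜 := ℂ) A‖ * ‖x‖) := by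
        gcongr
        exact ContinuousLinearMap.le_opNorm _ _
    _ = ‖A‖ * ∑ i, ‖v i‖ ^ 2 := by rw [← hx2, Matrix.cstar_norm_def]; ring

open scoped Matrix.Norms.L2Operator in
/-- **Wilson positivity and the width of the Wilson band, configuration-wise**: for every `SU(3)`
field `U`, every bare mass `m` and every spinor `v`,
`m Σ‖v‖² ≤ Re⟨v, D_W(U,m,1) v⟩ ≤ (m + 8) Σ‖v‖²` — from `D_W(m) = (m+4)·1 − Σ_μ W_μ` with four
hopping operators of `ℓ²`-norm `≤ 1` (tree `wilsonDirac_eq_sub_sum_wilsonHop`,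
`l2_opNorm_wilsonHop_le`; HJL (2.14)). The lower bound is `Re D_W(U,0,1) ≥ 0` (the Wilson term is
`½Σ∇†∇`), the upper bound says the hole's shadow on the real axis is `[0, 8]`. -/
theorem re_star_dotProduct_wilsonDirac_mem (U : GaugeConfig 4 L SU3) (m : ℝ)
    (v : TorusSite 4 L × Fin 3 × Fin 4 → ℂ) :
    m * ∑ i, ‖v i‖ ^ 2 ≤ (star v ⬝ᵥ (wilsonDirac (fundamentalRep (Fin 3)) U m 1 *ᵥ v)).re ∧
      (star v ⬝ᵥ (wilsonDirac (fundamentalRep (Fin 3)) U m 1 *ᵥ v)).re ≤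
        (m + 8) * ∑ i, ‖v i‖ ^ 2 := by
  have hρ : ∀ g : SU3, fundamentalRep (Fin 3) g ∈ Matrix.unitaryGroup (Fin 3) ℂ :=
    fundamentalRep_mem_unitaryGroup
  set N2 : ℝ := ∑ i, ‖v i‖ ^ 2 with hN2
  have hhop : ∀ μ : Fin 4, |(star v ⬝ᵥ (wilsonHop (fundamentalRep (Fin 3)) U μ *ᵥ v)).re| ≤ N2 := by
    intro μ
    refine (Complex.abs_re_le_norm _).trans ((norm_star_dotProduct_mulVec_le _ v).trans ?_)
    have h1 := l2_opNorm_wilsonHop_le (fundamentalRep (Fin 3)) hρ U μ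
    have hN : 0 ≤ N2 := Finset.sum_nonneg fun i _ => by positivity
    nlinarith
  have hre : (star v ⬝ᵥ (wilsonDirac (fundamentalRep (Fin 3)) U m 1 *ᵥ v)).re =
      (m + 4) * N2 - ∑ μ, (star v ⬝ᵥ (wilsonHop (fundamentalRep (Fin 3)) U μ *ᵥ v)).re := by
    rw [wilsonDirac_eq_sub_sum_wilsonHop (fundamentalRep (Fin 3)) hρ U m, sub_mulVec,
      smul_mulVec, one_mulVec, sum_mulVec, dotProduct_sub, dotProduct_smul, dotProduct_sum,
      Complex.sub_re, smul_eq_mul, Complex.re_ofReal_mul, Complex.re_sum, re_star_dotProduct_self]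
  have hsum : |∑ μ, (star v ⬝ᵥ (wilsonHop (fundamentalRep (Fin 3)) U μ *ᵥ v)).re| ≤ 4 * N2 := by
    refine (Finset.abs_sum_le_sum_abs _ _).trans ?_
    calc ∑ μ, |(star v ⬝ᵥ (wilsonHop (fundamentalRep (Fin 3)) U μ *ᵥ v)).re|
        ≤ ∑ _μ : Fin 4, N2 := Finset.sum_le_sum fun μ _ => hhop μ
      _ = 4 * N2 := by simp
  rw [hre]
  constructor <;> cases abs_le.1 hsum <;> linarith

/-- **No sign defects below a non-positive threshold.** The massless `r = 1` Wilson–Dirac operator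
of ANY `SU(3)` gauge field on ANY torus has no real eigenvalue `< t ≤ 0`: a real eigenvalue `λ < 0`
would make `D_W(U, -λ, 1)` singular, contradicting heavy-mass invertibility (`κ < 1/8`,
`wilsonDirac_det_ne_zero_of_pos`). -/
theorem countP_signDefect_eq_zero (U : GaugeConfig 4 L SU3) {t : ℝ} (ht : t ≤ 0) :
    Multiset.countP (fun z : ℂ => z.im = 0 ∧ z.re < t)
      (wilsonDirac (fundamentalRep (Fin 3)) U 0 1).charpoly.roots = 0 := by
  rw [Multiset.countP_eq_zero]
  rintro z hz ⟨hzim, hzre⟩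
  set D₀ := wilsonDirac (fundamentalRep (Fin 3)) U 0 1 with hD₀
  have hne : D₀.charpoly ≠ 0 := (Matrix.charpoly_monic _).ne_zero
  have heval : (Matrix.scalar _ z - D₀).det = 0 := by
    rw [← Matrix.eval_charpoly]; exact (Polynomial.mem_roots hne).1 hz
  have hz' : z = ((z.re : ℝ) : ℂ) := Complex.ext (by simp) (by simp [hzim])
  have hpos : 0 < -z.re := by linarith
  have hdet := wilsonDirac_det_ne_zero_of_pos (fundamentalRep (Fin 3))
    fundamentalRep_mem_unitaryGroup U hpos
  rw [wilsonDirac_mass_eq_add_scalar (fundamentalRep (Fin 3)) U (-z.re) 1] at hdet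
  apply hdet
  have hmat : wilsonDirac (fundamentalRep (Fin 3)) U 0 1 + Matrix.scalar _ (((-z.re : ℝ)) : ℂ) =
      -(Matrix.scalar _ z - D₀) := by
    rw [neg_sub, sub_eq_add_neg, ← map_neg, Complex.ofReal_neg, ← hz']
  rw [hmat, Matrix.det_neg, heval, mul_zero]

/-- **Every real eigenvalue of the massless Wilson–Dirac operator lies in `[0, 8]`** (the shadow
of the Wilson hole): a root `z` of the characteristic polynomial with `Im z = 0` has
`0 ≤ Re z ≤ 8` (Rayleigh quotient of an eigenvector and `re_star_dotProduct_wilsonDirac_mem`). -/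
theorem re_mem_Icc_of_real_root (U : GaugeConfig 4 L SU3) {z : ℂ}
    (hz : z ∈ (wilsonDirac (fundamentalRep (Fin 3)) U 0 1).charpoly.roots) (hzim : z.im = 0) :
    0 ≤ z.re ∧ z.re ≤ 8 := by
  set D₀ := wilsonDirac (fundamentalRep (Fin 3)) U 0 1 with hD₀
  have hne : D₀.charpoly ≠ 0 := (Matrix.charpoly_monic _).ne_zero
  have heval : (Matrix.scalar _ z - D₀).det = 0 := by
    rw [← Matrix.eval_charpoly]; exact (Polynomial.mem_roots hne).1 hz
  obtain ⟨v, hv0, hv⟩ := Matrix.exists_mulVec_eq_zero_iff.2 heval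
  have hDv : D₀ *ᵥ v = z • v := by
    rw [sub_mulVec, sub_eq_zero, scalar_apply, ← smul_one_eq_diagonal, smul_mulVec,
      one_mulVec] at hv
    exact hv.symm
  have hq : (star v ⬝ᵥ (D₀ *ᵥ v)).re = z.re * ∑ i, ‖v i‖ ^ 2 := by
    rw [hDv, dotProduct_smul, smul_eq_mul, Complex.mul_re, re_star_dotProduct_self, hzim,
      zero_mul, sub_zero]
  have h := re_star_dotProduct_wilsonDirac_mem U 0 v
  rw [hq, zero_mul, zero_add] at h
  have hN := sum_norm_sq_pos hv0
  exact ⟨nonneg_of_mul_nonneg_left h.1 hN, le_of_mul_le_mul_right h.2 hN⟩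

/-- **Coercivity off the line, configuration-wise.** For every bare mass `μ` (contentful for
`μ > 0`), every root `z` of the characteristic polynomial of the Hermitian Wilson operator
`Γ₅ D_W(U, μ, 1)` has `|Re z| ≥ μ`:
if `Γ₅ D v = z v` then `D v = z Γ₅ v`, so `μ‖v‖² ≤ Re⟨v, Dv⟩ = Re(z⟨v, Γ₅ v⟩) ≤ |z| ‖v‖²`, and
`z` is real (`Γ₅ D` Hermitian, barrier file `isHermitian_gammaFive_mul_wilsonDirac`). -/
theorem le_abs_re_of_mem_roots_hermitianWilson (U : GaugeConfig 4 L SU3) (μ : ℝ)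
    {z : ℂ} (hz : z ∈ (spinorLift gammaFive *
      wilsonDirac (fundamentalRep (Fin 3)) U μ 1).charpoly.roots) : μ ≤ |z.re| := by
  set Γ : Matrix (TorusSite 4 L × Fin 3 × Fin 4) (TorusSite 4 L × Fin 3 × Fin 4) ℂ :=
    spinorLift gammaFive with hΓ
  set D := wilsonDirac (fundamentalRep (Fin 3)) U μ 1 with hD
  have hne : (Γ * D).charpoly ≠ 0 := (Matrix.charpoly_monic _).ne_zero
  -- `z` is real: `Γ₅ D` is Hermitian
  have hH : (Γ * D).IsHermitian :=
    Literature.Barriers.QuantumFields.isHermitian_gammaFive_mul_wilsonDirac (fundamentalRep (Fin 3))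
      fundamentalRep_mem_unitaryGroup U μ 1
  have hzim : z.im = 0 := by
    have hz2 := hz
    rw [hH.roots_charpoly_eq_eigenvalues, Multiset.mem_map] at hz2
    obtain ⟨i, -, rfl⟩ := hz2
    simp
  -- an eigenvector
  have heval : (Matrix.scalar _ z - Γ * D).det = 0 := by
    rw [← Matrix.eval_charpoly]; exact (Polynomial.mem_roots hne).1 hz
  obtain ⟨v, hv0, hv⟩ := Matrix.exists_mulVec_eq_zero_iff.2 heval
  have hHv : Γ *ᵥ (D *ᵥ v) = z • v := by
    rw [sub_mulVec, sub_eq_zero, scalar_apply, ← smul_one_eq_diagonal, smul_mulVec,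
      one_mulVec, ← mulVec_mulVec] at hv
    exact hv.symm
  have hΓΓ : Γ * Γ = 1 := spinorLift_gammaFive_mul_self
  have hDv : D *ᵥ v = z • (Γ *ᵥ v) := by
    calc D *ᵥ v = (Γ * Γ * D) *ᵥ v := by rw [hΓΓ, Matrix.one_mul]
      _ = Γ *ᵥ (Γ *ᵥ (D *ᵥ v)) := by simp only [mulVec_mulVec, Matrix.mul_assoc]
      _ = z • (Γ *ᵥ v) := by rw [hHv, mulVec_smul]
  -- the chirality form `g = ⟨v, Γ₅ v⟩` has `‖g‖ ≤ ‖v‖²`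
  set N2 : ℝ := ∑ i, ‖v i‖ ^ 2 with hN2
  have hN2pos : 0 < N2 := sum_norm_sq_pos hv0
  have hΓv : ∀ p, (Γ *ᵥ v) p = (![1, 1, -1, -1] : Fin 4 → ℂ) p.2.2 * v p := by
    intro p
    rw [hΓ, spinorLift_gammaFive_eq_diagonal, mulVec_diagonal]
  have hg : ‖star v ⬝ᵥ (Γ *ᵥ v)‖ ≤ N2 := by
    rw [dotProduct]
    refine (norm_sum_le _ _).trans (le_of_eq ?_)
    refine Finset.sum_congr rfl fun p _ => ?_
    rw [hΓv, Pi.star_apply, norm_mul, norm_mul, Complex.star_def, Complex.norm_conj]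
    have h1 : ‖(![1, 1, -1, -1] : Fin 4 → ℂ) p.2.2‖ = 1 := by
      rcases p with ⟨x, a, α⟩
      fin_cases α <;> simp
    rw [h1, one_mul, sq]
  -- Wilson positivity: `Re⟨v, D v⟩ ≥ μ ‖v‖²`
  have hpos : μ * N2 ≤ (star v ⬝ᵥ (D *ᵥ v)).re := (re_star_dotProduct_wilsonDirac_mem U μ v).1
  -- combine
  have hup : (star v ⬝ᵥ (D *ᵥ v)).re ≤ |z.re| * N2 := by
    rw [hDv, dotProduct_smul, smul_eq_mul]
    have hz' : z = ((z.re : ℝ) : ℂ) := Complex.ext (by simp) (by simp [hzim])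
    calc (z * (star v ⬝ᵥ (Γ *ᵥ v))).re ≤ ‖z * (star v ⬝ᵥ (Γ *ᵥ v))‖ := Complex.re_le_norm _
      _ = |z.re| * ‖star v ⬝ᵥ (Γ *ᵥ v)‖ := by
          rw [norm_mul, hz', Complex.norm_real, Real.norm_eq_abs, Complex.ofReal_re]
      _ ≤ |z.re| * N2 := mul_le_mul_of_nonneg_left hg (abs_nonneg _)
  exact le_of_mul_le_mul_right (hpos.trans hup) hN2pos

/-- **No coercivity defects in a window narrower than the bare mass.** For any window
half-width `w ≤ μ`, `Γ₅ D_W(U, μ, 1)` has no eigenvalue with `|Re| < w`. -/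
theorem countP_coercivityDefect_eq_zero (U : GaugeConfig 4 L SU3) {μ w : ℝ} (hw : w ≤ μ) :
    Multiset.countP (fun z : ℂ => |z.re| < w)
      (spinorLift gammaFive * wilsonDirac (fundamentalRep (Fin 3)) U μ 1).charpoly.roots = 0 := by
  rw [Multiset.countP_eq_zero]
  intro z hz hlt
  have := le_abs_re_of_mem_roots_hermitianWilson U μ hz
  linarith

end Spectral


/-! ## §2 Load-bearing analysis: without TIGHT the bridge is the summit conjunct -/

section LoadBearing

variable {Nf : ℕ}

/-- **The EXTINCT integrand vanishes identically when the line sits at non-negative bare mass.**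
For every regularisation step with `m_crit(k) ≥ 0`, every `c ≤ 1`, every positive mass tuple and
EVERY gauge field: no sign defects (threshold `-(m_crit + a m_f/Z) < 0`,
`countP_signDefect_eq_zero`) and no coercivity defects (window `c a m_f/Z ≤ m_crit + a m_f/Z`,
`countP_coercivityDefect_eq_zero`). -/
theorem defectCount_eq_zero (reg : QCDRegularisation Nf) {k : ℕ} (hk : 0 ≤ reg.mcrit k)
    {c : ℝ} (hc1 : c ≤ 1) (m : Fin Nf → ℝ) (hm : ∀ f, 0 < m f) {S : ℕ} [NeZero S]
    (U : GaugeConfig 4 S SU3) :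
    (∑ f : Fin Nf, ((Multiset.countP (fun z : ℂ => z.im = 0 ∧ z.re < -(reg.mcrit k + reg.a k * m f / reg.Zm k)) (wilsonDirac (fundamentalRep (Fin 3)) U 0 1).charpoly.roots : ℝ) + (Multiset.countP (fun z : ℂ => |z.re| < c * (reg.a k * m f / reg.Zm k)) (spinorLift gammaFive * wilsonDirac (fundamentalRep (Fin 3)) U (reg.mcrit k + reg.a k * m f / reg.Zm k) 1).charpoly.roots : ℝ))) = 0 := by
  refine Finset.sum_eq_zero fun f _ => ?_
  have hw : 0 < reg.a k * m f / reg.Zm k := div_pos (mul_pos (reg.a_pos k) (hm f)) (reg.Zm_pos k)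
  have hcw : c * (reg.a k * m f / reg.Zm k) ≤ reg.mcrit k + reg.a k * m f / reg.Zm k := by
    nlinarith
  rw [countP_signDefect_eq_zero U (by linarith), countP_coercivityDefect_eq_zero U hcw,
    Nat.cast_zero, add_zero]

/-- **EXTINCT is free for a line at non-negative bare mass.** For EVERY regularisation with
`m_crit(k) ≥ 0` for all `k` (no scaling, coupling or volume hypothesis used), every `c ≤ 1` and
every positive mass tuple, the EXTINCT clause holds — its numerator is the integral of `0`. -/
theorem extinct_of_mcrit_nonneg (reg : QCDRegularisation Nf) (hcrit : ∀ k, 0 ≤ reg.mcrit k)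
    {c : ℝ} (hc1 : c ≤ 1) (m : Fin Nf → ℝ) (hm : ∀ f, 0 < m f) : Extinct Nf reg c m := by
  intro ε hε
  refine Filter.Eventually.of_forall fun k S _ => ?_
  simp only [defectCount_eq_zero reg (hcrit k) hc1 m hm, zero_mul, integral_zero, zero_div]
  positivity

variable (Nf) in
/-- `SD(N_f)` with the TIGHT clause deleted. -/
def SDWithoutTight : Prop :=
  ∃ reg : QCDRegularisation Nf, reg.HasMassScaling ∧ (reg.scheme 0 0 0).HasAsymptoticScaling ∧
    ∃ M₀ : ℝ, 0 ≤ M₀ ∧ ∃ c : ℝ, 0 < c ∧ ∀ m : Fin Nf → ℝ, (∀ f, M₀ < m f) → Extinct Nf reg c m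

/-- `SD` is `SDWithoutTight` plus TIGHT (sanity: the deletion is faithful). -/
theorem sdWithoutTight_of_sdHyp (h : SDHyp Nf) : SDWithoutTight Nf := by
  obtain ⟨reg, h1, h2, M₀, hM₀, c, hc, h⟩ := h
  exact ⟨reg, h1, h2, M₀, hM₀, c, hc, fun m hm => (h m hm).1⟩

variable (Nf) in
/-- **Junk witness.** The degenerate tree regularisation `canonicalAF` (`a_k = 1/(k+1)`,
`L_k = (k+1)²`, `β_k = afBeta N_f 1 a_k`, `m_crit ≡ 0`, `Z_m(k) = (log a_k⁻²)^{γ₀/(2β₀)}`) is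
mass-scaling, asymptotically scaling and satisfies EXTINCT with `M₀ = 0`, `c = 1`. -/
theorem sdWithoutTight_canonicalAF : SDWithoutTight Nf :=
  ⟨QCDRegularisation.canonicalAF Nf, QCDRegularisation.canonicalAF_hasMassScaling,
    QCDScheme.zeroAF_hasAsymptoticScaling, 0, le_rfl, 1, one_pos,
    fun m hm => extinct_of_mcrit_nonneg _ (fun _ => le_rfl) le_rfl m hm⟩

/-- The crux with TIGHT deleted from its hypothesis. -/
def ExtinctionBuildsQCDWithoutTight : Prop :=
  ∀ Nf : ℕ, (Nf = 2 ∨ Nf = 3) → SDWithoutTight Nf → QCDOf Nf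

/-- **LOAD-BEARING: without TIGHT the bridge IS the summit conjunct** (`QCD = QCDOf 2 ∧ QCDOf 3`).
Any proof of `ExtinctionBuildsQCD` must use TIGHT; EXTINCT (sign AND coercivity counts, any
`c ≤ 1`), mass scaling and asymptotic scaling together carry no information. -/
theorem extinctionBuildsQCDWithoutTight_iff_qcd : ExtinctionBuildsQCDWithoutTight ↔ _root_.QCD :=
  ⟨fun h => ⟨h 2 (Or.inl rfl) (sdWithoutTight_canonicalAF 2),
      h 3 (Or.inr rfl) (sdWithoutTight_canonicalAF 3)⟩,
    fun hq Nf hNf _ => by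
      rcases hNf with rfl | rfl
      exacts [hq.1, hq.2]⟩

/-- **Collapse schema for candidate repairs of TIGHT.** Replacing TIGHT by ANY side condition `P`
on the regularisation that the degenerate witness `canonicalAF` happens to satisfy — e.g.
"`m_crit(k) ∈ [-8, 0]`", "`m_crit(k) → 0`", "`|m_crit(k)| ≤ C g₀(k)²`", "`m_crit` flavour-blind and
monotone" — still yields a statement equivalent to the summit conjunct. Only a condition with
INDEX content (net chirality of real modes just past the line) can pin the line. -/
theorem bridge_collapse_schema (P : ∀ Nf : ℕ, QCDRegularisation Nf → Prop)
    (hP : ∀ Nf, P Nf (QCDRegularisation.canonicalAF Nf)) :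
    (∀ Nf : ℕ, (Nf = 2 ∨ Nf = 3) →
      (∃ reg : QCDRegularisation Nf, P Nf reg ∧ reg.HasMassScaling ∧
        (reg.scheme 0 0 0).HasAsymptoticScaling ∧ ∃ M₀ : ℝ, 0 ≤ M₀ ∧ ∃ c : ℝ, 0 < c ∧
          ∀ m : Fin Nf → ℝ, (∀ f, M₀ < m f) → Extinct Nf reg c m) → QCDOf Nf) ↔ _root_.QCD := by
  have hw : ∀ Nf, ∃ reg : QCDRegularisation Nf, P Nf reg ∧ reg.HasMassScaling ∧
      (reg.scheme 0 0 0).HasAsymptoticScaling ∧ ∃ M₀ : ℝ, 0 ≤ M₀ ∧ ∃ c : ℝ, 0 < c ∧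
        ∀ m : Fin Nf → ℝ, (∀ f, M₀ < m f) → Extinct Nf reg c m := fun Nf =>
    ⟨QCDRegularisation.canonicalAF Nf, hP Nf, QCDRegularisation.canonicalAF_hasMassScaling,
      QCDScheme.zeroAF_hasAsymptoticScaling, 0, le_rfl, 1, one_pos,
      fun m hm => extinct_of_mcrit_nonneg _ (fun _ => le_rfl) le_rfl m hm⟩
  exact ⟨fun h => ⟨h 2 (Or.inl rfl) (hw 2), h 3 (Or.inr rfl) (hw 3)⟩,
    fun hq Nf hNf _ => by
      rcases hNf with rfl | rfl
      exacts [hq.1, hq.2]⟩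

/-- Instance of the schema: pinning the line into the shadow of the Wilson hole, `m_crit(k) ∈
[-8, 0]` for all `k` (which TIGHT does force, §3), is NOT a substitute for TIGHT. -/
theorem extinctionBuildsQCDWithLinePinned_iff_qcd :
    (∀ Nf : ℕ, (Nf = 2 ∨ Nf = 3) →
      (∃ reg : QCDRegularisation Nf, (∀ k, -8 ≤ reg.mcrit k ∧ reg.mcrit k ≤ 0) ∧
        reg.HasMassScaling ∧ (reg.scheme 0 0 0).HasAsymptoticScaling ∧ ∃ M₀ : ℝ, 0 ≤ M₀ ∧
          ∃ c : ℝ, 0 < c ∧ ∀ m : Fin Nf → ℝ, (∀ f, M₀ < m f) → Extinct Nf reg c m) → QCDOf Nf) ↔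
      _root_.QCD :=
  bridge_collapse_schema (fun _ reg => ∀ k, -8 ≤ reg.mcrit k ∧ reg.mcrit k ≤ 0)
    fun _ _ => ⟨by norm_num [QCDRegularisation.canonicalAF], le_rfl⟩

end LoadBearing

end Summit.QuantumFields.QCD.Theorems.ExtinctionBuildsQCD.Negative

end
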